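import Literature.AlgebraicGeometry.Motives.HodgeStructureFourierTransformIntegralLattice
import HarnessLib

/-!
# Divided powers on `H•(X, ℤ) ⊂ ⋀W`: `x^r ∈ r!·H•(X, ℤ)` for every integral class without constant term (Papy 1950; Kahn 2026 §3),
# and the Pontryagin shadow `x^{⋆r} ∈ r!·H•(X, ℤ)` (Kahn 2026 Cor. 1.4 / Moonen–Polishchuk, on cohomology)

[topic AlgebraicGeometry/Motives]

Layer `Literature/AlgebraicGeometry/Motives` (namespace `Literature.AlgebraicGeometry.Motives.ExteriorLefschetz`), lane `lit-hodgefound`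
(Track 2 foundations library; prover seat `lit-hodgefound-p34`, generation 39, row g39-#4).  THEOREMS ONLY (no `def`, no named fact, no
instance, no notation; net debt `0`).  Sequel of row g39-#1 (`HodgeStructureFourierTransformIntegralLattice`: the integral lattice
`L = H•(X, ℤ) = Submodule.span ℤ (range (weightBasis b))` of the Darboux monomials `w_A`, a subring of `⋀W`; `ℱ(L) = L`, `ℱ(w_A) = ± w_{flip(Aᶜ)}`,
`L ⋆ L ⊆ L`), of rows g37-#3/#4 (`ℱ(x ⋆ y) = ℱx ∧ ℱy`, `ℱ([pt]) = 1`, `ℱ⁴ = 1`) and g35 (`⋆`, its unit `[pt] = θ^g/g!`).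

THE SETTING. `K` a field of characteristic `0`; `b` a Darboux basis of `W = H¹(X, K)`, `θ = twoVector b` (principal polarization),
`w_A = weightBasis b A` (`A ⊆ {e₁ < f₁ < ⋯ < e_g < f_g}`), `L = span_ℤ {w_A} = H•(X, ℤ)`; the AUGMENTATION IDEALS `H^{>0}(X, ℤ) = span_ℤ {w_A : A ≠ ∅}`
(for the cup product) and `H^{<2g}(X, ℤ) = span_ℤ {w_A : A ≠ univ}` (for the Pontryagin product, whose unit is `[pt] = w_{univ} = θ^g/g!`);
`x^{⋆r} = (x ⋆ ·)^r [pt]` (`((isSymplectic_twoVector b).pontryagin x ^ r) [pt]`).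

## Sources, VERBATIM

B. Kahn, *Divided powers on abelian varieties*, arXiv:2602.11135 (2026) [Kahn2026DividedPowers] (held text `paper:arxiv-2602.11135`), §3, proof
of Prop. 1.1 (p0006 L3): "the even part of the cohomology algebra `H*_cont(A, ℤ_l)` has a divided power structure [Papy, Revoy]. Thus `cl_l(x^r)
= cl_l(x)^r` is divisible by `r!`"; Remark 3.1: "If `j` is odd and `p ≠ 2`, we even have `x² = 0` because `2x² = 0` a priori"; Thm. 1.2 (a)
(p0003 L36): "There exists a canonical divided power structure on the ideal `CH̄^{>0}_ét(A)` of `CH̄^*_ét(A)`"; **Cor. 1.4** (p0003 L46): "The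
augmentation ideal of `CH̄_*^ét(A)` provided with the Pontryagin product admits a canonical divided power structure."  ([Papy] = G. Papy,
*Une propriété arithmétique des algèbres de Grassmann*, 1950 — the Grassmann algebra over `ℤ`.)
T. Beckmann, O. de Gaay Fortman, Compositio Math. 159 (2023) [BeckmannDeGaayFortman2023] (held `paper:arxiv-2202.05230`, p0002 L70–L72), Thm.
(Moonen–Polishchuk): "The ring `(CH(A), ⋆)` admits a canonical PD-structure `γ` on the ideal `CH_{>0}(A) ⊂ CH(A)` […] for each element
`x ∈ CH_{>0}(A)` and each `n ∈ ℤ_{≥1}`, there is a canonical element `x^{[n]} ∈ CH_{>0}(A)` such that `n! x^{[n]} = x^{⋆n}`".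
N. Bourbaki, *Algèbre* Ch. III [BourbakiAlgebre1a3] (cite-only), §7 no. 1 and no. 8 Thm. 1 (graded commutativity; the basis `e_I`, `e_I ∧ e_I = 0`).

## What is PROVED (all `theorem`s) — the COHOMOLOGICAL SHADOW of these divided-power structures, as divisibility statements in `⋀W`

* §1 generators: `weightBasis_mul_self_eq_zero` (`w_A ∧ w_A = 0`, `A ≠ ∅`), `weightBasis_pow_eq_zero`, `commute_weightBasis_of_even` (even
  monomials are central), `weightBasis_mul_add_mul_eq_zero_of_odd` (odd monomials anticommute).
* §2 **`mem_span_image_weightBasis_iff`**: `x ∈ span_ℤ {w_A : p A} ⟺` all coordinates of `x` are integers and vanish off `p` (Mathlib's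
  `Basis.mem_span_iff_repr_mem`); `span_image_weightBasis_le`.
* §3 EVEN PART: `commute_of_mem_span_even`, **`exists_pow_eq_factorial_smul_of_mem_span_even`** — for `x ∈ span_ℤ {w_A : A ≠ ∅, |A| even}`,
  `x^r = r!·y` with `y ∈ L` (binomial theorem for commuting elements, `C(r,m)·m!·(r−m)! = r!`): "the even part has a divided power structure".
* §4 ODD PART: `mul_add_mul_eq_zero_of_mem_span_odd`, **`mul_self_eq_zero_of_mem_span_odd`** (`x ∧ x = 0` for odd `x`: "`2x² = 0`"), and the
  nilpotent binomial identity `add_pow_succ_of_commute_of_mul_self` (`(e + o)^{r+1} = e^{r+1} + (r+1)·e^r o` for `eo = oe`, `o² = 0`).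
* §5 **`exists_pow_eq_factorial_smul_of_mem_span_nonempty`** and **`exists_pow_eq_factorial_smul`**: FOR EVERY `x ∈ H•(X, ℤ)` WITH VANISHING
  CONSTANT TERM (`c_∅(x) = 0`) AND EVERY `r`, `x^r ∈ r!·H•(X, ℤ)` — the augmentation ideal `H^{>0}(X, ℤ)` of the integral Grassmann algebra has
  divided powers (Papy; Kahn §3).
* §6 THE PONTRYAGIN SHADOW: `fourierTransform_pontryagin_pow_point` (`ℱ((x ⋆)^r [pt]) = (ℱx)^r`), `fourierTransform_mem_span_nonempty`
  (`ℱ(H^{<2g}(X, ℤ)) ⊆ H^{>0}(X, ℤ)`), and **`exists_pontryagin_pow_point_eq_factorial_smul`**: FOR `x ∈ H•(X, ℤ)` WITH `c_{univ}(x) = 0` (no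
  point-class component), `x^{⋆r} ∈ r!·H•(X, ℤ)` — Kahn's Cor. 1.4 / Moonen–Polishchuk read in integral cohomology through the integral ring
  isomorphism `ℱ : (H•(X, ℤ), ⋆) ⥲ (H•(X, ℤ), ∧)` (rows g39-#1, g37-#4).

Not here: Chow groups, étale motivic cohomology, the PD-axioms for the operations `x ↦ x^r/r!` themselves (only the divisibility they express).

## References

* [Kahn2026DividedPowers] B. Kahn, *Divided powers on abelian varieties*, arXiv:2602.11135 (2026), §3 (proof of Prop. 1.1), Rem. 3.1, Thm. 1.2,
  Cor. 1.4; citing G. Papy (1950) and P. Revoy for the Grassmann algebra.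
* [BeckmannDeGaayFortman2023] T. Beckmann, O. de Gaay Fortman, *Integral Fourier transforms and the integral Hodge conjecture for one-cycles on
  abelian varieties*, Compositio Math. 159 (2023), §2 Thm. (Moonen–Polishchuk).
* [BourbakiAlgebre1a3] N. Bourbaki, *Algèbre*, Ch. III §7 no. 1, no. 8 Thm. 1 (cite-only).
-/

noncomputable section

open scoped Nat

namespace Literature.AlgebraicGeometry.Motives

namespace ExteriorLefschetz

open ExteriorAlgebra Module

section Ring

variable {K : Type*} [CommRing K] {W : Type*} [AddCommGroup W] [Module K W] {g : ℕ} (b : Basis (Fin g ⊕ Fin g) K W)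

/-! ## §1 Generators: `w_A ∧ w_A = 0`, even monomials are central, odd monomials anticommute -/

/-- `w_A ∧ w_A = 0` for `A ≠ ∅` (a repeated letter). [cite: BourbakiAlgebre1a3, Ch. III §7 no. 8 Thm. 1] -/
theorem weightBasis_mul_self_eq_zero {A : Finset (Fin g ×ₗ Bool)} (hA : A.Nonempty) : weightBasis b A * weightBasis b A = 0 :=
  weightBasis_mul_eq_zero_of_not_disjoint b fun h ↦ hA.ne_empty (by rwa [disjoint_self, Finset.bot_eq_empty] at h)

/-- `w_A^r = 0` for `A ≠ ∅`, `r ≥ 2`. [cite: BourbakiAlgebre1a3, Ch. III §7 no. 8 Thm. 1] -/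
theorem weightBasis_pow_eq_zero {A : Finset (Fin g ×ₗ Bool)} (hA : A.Nonempty) {r : ℕ} (hr : 2 ≤ r) : weightBasis b A ^ r = 0 := by
  rw [show r = 2 + (r - 2) by omega, pow_add, pow_two, weightBasis_mul_self_eq_zero b hA, zero_mul]

end Ring

section Field

variable {K : Type*} [Field K] [CharZero K] {W : Type*} [AddCommGroup W] [Module K W] {g : ℕ} (b : Basis (Fin g ⊕ Fin g) K W)

omit [CharZero K] in
/-- **Even monomials are central**: `w_A ∧ y = y ∧ w_A` for `|A|` even. [cite: BourbakiAlgebre1a3, Ch. III §7 no. 1 (graded commutativity)] -/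
theorem commute_weightBasis_of_even {A : Finset (Fin g ×ₗ Bool)} (hA : Even A.card) (y : ExteriorAlgebra K W) : Commute (weightBasis b A) y := by
  obtain ⟨k, hk⟩ := hA
  have hm : weightBasis b A ∈ ⋀[K]^(2 * k) W := by
    rw [show 2 * k = A.card by omega]
    exact weightBasis_mem b A
  exact mul_comm_of_mem_two_mul hm y

omit [CharZero K] in
/-- **Odd monomials anticommute**: `w_A ∧ w_B + w_B ∧ w_A = 0` for `|A|, |B|` odd. [cite: BourbakiAlgebre1a3, Ch. III §7 no. 1 (graded commutativity)] -/
theorem weightBasis_mul_add_mul_eq_zero_of_odd {A B : Finset (Fin g ×ₗ Bool)} (hA : Odd A.card) (hB : Odd B.card) :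
    weightBasis b A * weightBasis b B + weightBasis b B * weightBasis b A = 0 := by
  rw [mul_comm_of_mem (weightBasis_mem b A) (weightBasis_mem b B), (hA.mul hB).neg_one_pow, neg_one_smul, neg_add_cancel]

/-! ## §2 Sub-spans of the lattice by index predicates: integral coordinates vanishing off the predicate -/

omit [CharZero K] in
/-- **`x ∈ span_ℤ {w_A : p A} ⟺ every coordinate of `x` is an integer and the coordinates off `p` vanish`** (the monomials are a `K`-basis).
[cite: BourbakiAlgebre1a3, Ch. III §7 no. 8 Thm. 1] -/
theorem mem_span_image_weightBasis_iff (p : Finset (Fin g ×ₗ Bool) → Prop) {x : ExteriorAlgebra K W} :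
    x ∈ Submodule.span ℤ (weightBasis b '' {A | p A}) ↔
      (∀ A, (weightBasis b).repr x A ∈ Set.range (algebraMap ℤ K)) ∧ ∀ A, ¬p A → (weightBasis b).repr x A = 0 := by
  classical
  constructor
  · intro hx
    induction hx using Submodule.span_induction with
    | mem y hy =>
      obtain ⟨B, hB, rfl⟩ := hy
      refine ⟨fun A ↦ ?_, fun A hA ↦ ?_⟩
      · rw [Basis.repr_self, Finsupp.single_apply]
        split_ifs
        · exact ⟨1, by rw [map_one]⟩
        · exact ⟨0, by rw [map_zero]⟩
      · rw [Basis.repr_self, Finsupp.single_apply, if_neg]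
        rintro rfl
        exact hA hB
    | zero => exact ⟨fun A ↦ ⟨0, by rw [map_zero, map_zero, Finsupp.zero_apply]⟩, fun A _ ↦ by rw [map_zero, Finsupp.zero_apply]⟩
    | add y z _ _ hy hz =>
      refine ⟨fun A ↦ ?_, fun A hA ↦ by rw [map_add, Finsupp.add_apply, hy.2 A hA, hz.2 A hA, add_zero]⟩
      obtain ⟨m, hm⟩ := hy.1 A
      obtain ⟨n, hn⟩ := hz.1 A
      exact ⟨m + n, by rw [map_add, map_add, Finsupp.add_apply, hm, hn]⟩
    | smul n y _ hy =>
      refine ⟨fun A ↦ ?_, fun A hA ↦ by rw [map_zsmul, Finsupp.smul_apply, hy.2 A hA, smul_zero]⟩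
      obtain ⟨m, hm⟩ := hy.1 A
      exact ⟨n * m, by rw [map_zsmul, Finsupp.smul_apply, ← hm, map_mul, zsmul_eq_mul, eq_intCast (algebraMap ℤ K) n]⟩
  · rintro ⟨hint, hp⟩
    rw [← (weightBasis b).sum_repr x]
    refine Submodule.sum_mem _ fun A _ ↦ ?_
    by_cases hA : p A
    · obtain ⟨m, hm⟩ := hint A
      rw [← hm, algebraMap_int_eq, eq_intCast, Int.cast_smul_eq_zsmul]
      exact Submodule.smul_mem _ _ (Submodule.subset_span ⟨A, hA, rfl⟩)
    · rw [hp A hA, zero_smul]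
      exact Submodule.zero_mem _

/-- `x ∈ H•(X, ℤ) ⟺` all coordinates of `x` are integers. [cite: BourbakiAlgebre1a3, Ch. III §7 no. 8 Thm. 1] -/
theorem mem_span_weightBasis_iff_forall_repr_mem {x : ExteriorAlgebra K W} :
    x ∈ Submodule.span ℤ (Set.range (weightBasis b)) ↔ ∀ A, (weightBasis b).repr x A ∈ Set.range (algebraMap ℤ K) :=
  Basis.mem_span_iff_repr_mem ℤ (weightBasis b) x

omit [CharZero K] in
/-- A sub-span by an index predicate lies in the lattice. [cite: BourbakiAlgebre1a3, Ch. III §7 no. 8 Thm. 1] -/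
theorem span_image_weightBasis_le (s : Set (Finset (Fin g ×ₗ Bool))) :
    Submodule.span ℤ (weightBasis b '' s) ≤ Submodule.span ℤ (Set.range (weightBasis b)) :=
  Submodule.span_mono (Set.image_subset_range _ _)

/-- **`x ∈ H^{>0}(X, ℤ) = span_ℤ {w_A : A ≠ ∅} ⟺ x ∈ H•(X, ℤ)` and its constant term `c_∅(x)` vanishes.** [cite: Kahn2026DividedPowers, Thm. 1.2 (a) (the ideal of positive-degree classes)]
[cite: BourbakiAlgebre1a3, Ch. III §7 no. 8 Thm. 1] -/
theorem mem_span_image_weightBasis_nonempty_iff {x : ExteriorAlgebra K W} :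
    x ∈ Submodule.span ℤ (weightBasis b '' {A | A.Nonempty}) ↔
      x ∈ Submodule.span ℤ (Set.range (weightBasis b)) ∧ (weightBasis b).repr x ∅ = 0 := by
  rw [mem_span_image_weightBasis_iff, mem_span_weightBasis_iff_forall_repr_mem]
  refine ⟨fun h ↦ ⟨h.1, h.2 ∅ Finset.not_nonempty_empty⟩, fun h ↦ ⟨h.1, fun A hA ↦ ?_⟩⟩
  rw [Finset.not_nonempty_iff_eq_empty] at hA
  rw [hA, h.2]

/-- **`x ∈ H^{<2g}(X, ℤ) = span_ℤ {w_A : A ≠ univ} ⟺ x ∈ H•(X, ℤ)` and its point-class coordinate `c_{univ}(x)` vanishes** (the augmentation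
ideal for the Pontryagin product, whose unit is `[pt] = w_{univ}`). [cite: Kahn2026DividedPowers, Cor. 1.4 (the augmentation ideal for the Pontryagin product)]
[cite: BourbakiAlgebre1a3, Ch. III §7 no. 8 Thm. 1] -/
theorem mem_span_image_weightBasis_ne_univ_iff {x : ExteriorAlgebra K W} :
    x ∈ Submodule.span ℤ (weightBasis b '' {A | A ≠ Finset.univ}) ↔
      x ∈ Submodule.span ℤ (Set.range (weightBasis b)) ∧ (weightBasis b).repr x Finset.univ = 0 := by
  rw [mem_span_image_weightBasis_iff, mem_span_weightBasis_iff_forall_repr_mem]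
  refine ⟨fun h ↦ ⟨h.1, h.2 _ fun h ↦ h rfl⟩, fun h ↦ ⟨h.1, fun A hA ↦ ?_⟩⟩
  rw [not_ne_iff] at hA
  rw [hA, h.2]

/-! ## §3 The even part: `x^r ∈ r!·L` (binomial theorem for commuting square-zero generators) -/

omit [CharZero K] in
/-- Elements of the even positive span are central. [cite: BourbakiAlgebre1a3, Ch. III §7 no. 1 (graded commutativity)] -/
theorem commute_of_mem_span_even {x : ExteriorAlgebra K W}
    (hx : x ∈ Submodule.span ℤ (weightBasis b '' {A | A.Nonempty ∧ Even A.card})) (y : ExteriorAlgebra K W) : Commute x y := by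
  induction hx using Submodule.span_induction with
  | mem z hz =>
    obtain ⟨A, hA, rfl⟩ := hz
    exact commute_weightBasis_of_even b hA.2 y
  | zero => exact Commute.zero_left y
  | add z z' _ _ hz hz' => exact hz.add_left hz'
  | smul n z _ hz =>
    rw [zsmul_eq_mul]
    exact (Int.cast_commute n y).mul_left hz

omit [CharZero K] in
/-- **THE EVEN PART OF `H^{>0}(X, ℤ)` HAS DIVIDED POWERS: `x^r = r!·y` with `y ∈ H•(X, ℤ)`** for `x ∈ span_ℤ {w_A : A ≠ ∅, |A| even}` — the
generators are central and square to `0`, and for commuting `x, y` with `x^m ∈ m!·L`, `y^m ∈ m!·L` the binomial theorem and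
`C(r,m)·m!·(r−m)! = r!` give `(x + y)^r ∈ r!·L` ("the even part of the cohomology algebra has a divided power structure [Papy, Revoy]").
[cite: Kahn2026DividedPowers, §3 (proof of Prop. 1.1: "the even part … has a divided power structure. Thus cl(x^r) = cl(x)^r is divisible by r!")] -/
theorem exists_pow_eq_factorial_smul_of_mem_span_even {x : ExteriorAlgebra K W}
    (hx : x ∈ Submodule.span ℤ (weightBasis b '' {A | A.Nonempty ∧ Even A.card})) (r : ℕ) :
    ∃ y ∈ Submodule.span ℤ (Set.range (weightBasis b)), x ^ r = (r ! : ℤ) • y := by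
  induction hx using Submodule.span_induction generalizing r with
  | mem z hz =>
    obtain ⟨A, hA, rfl⟩ := hz
    rcases r with _ | _ | r
    · exact ⟨1, one_mem_span_weightBasis b, by rw [pow_zero, Nat.factorial_zero, Nat.cast_one, one_smul]⟩
    · exact ⟨weightBasis b A, Submodule.subset_span ⟨A, rfl⟩, by rw [zero_add, pow_one, Nat.factorial_one, Nat.cast_one, one_smul]⟩
    · exact ⟨0, Submodule.zero_mem _, by rw [weightBasis_pow_eq_zero b hA.1 (by omega), smul_zero]⟩
  | zero =>
    rcases r with _ | r
    · exact ⟨1, one_mem_span_weightBasis b, by rw [pow_zero, Nat.factorial_zero, Nat.cast_one, one_smul]⟩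
    · exact ⟨0, Submodule.zero_mem _, by rw [zero_pow (Nat.succ_ne_zero r), smul_zero]⟩
  | add z z' hz _ ihz ihz' =>
    choose a ha using ihz
    choose c hc using ihz'
    refine ⟨∑ m ∈ Finset.range (r + 1), a m * c (r - m), Submodule.sum_mem _ fun m _ ↦ mul_mem_span_weightBasis b (ha m).1 (hc _).1, ?_⟩
    rw [(commute_of_mem_span_even b hz z').add_pow, Finset.smul_sum]
    refine Finset.sum_congr rfl fun m hm ↦ ?_
    have hmr : m ≤ r := Finset.mem_range_succ_iff.mp hm
    have hfact : ((r.choose m : ℕ) : ℤ) * ((m ! : ℕ) : ℤ) * (((r - m)! : ℕ) : ℤ) = (r ! : ℤ) := by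
      exact_mod_cast Nat.choose_mul_factorial_mul_factorial hmr
    rw [(ha m).2, (hc (r - m)).2, smul_mul_smul_comm, ← Nat.cast_comm, ← nsmul_eq_mul, ← natCast_zsmul, smul_smul, ← hfact]
    congr 1
    ring
  | smul n z _ ihz =>
    obtain ⟨a, ha, hza⟩ := ihz r
    refine ⟨n ^ r • a, Submodule.smul_mem _ _ ha, ?_⟩
    rw [smul_pow, hza, smul_comm]

/-! ## §4 The odd part squares to zero; the nilpotent binomial identity -/

omit [CharZero K] in
/-- Odd elements anticommute: `x ∧ y + y ∧ x = 0` for `x, y ∈ span_ℤ {w_A : |A| odd}`. [cite: BourbakiAlgebre1a3, Ch. III §7 no. 1 (graded commutativity)]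
[cite: Kahn2026DividedPowers, Rem. 3.1 ("2x² = 0")] -/
theorem mul_add_mul_eq_zero_of_mem_span_odd {x y : ExteriorAlgebra K W} (hx : x ∈ Submodule.span ℤ (weightBasis b '' {A | Odd A.card}))
    (hy : y ∈ Submodule.span ℤ (weightBasis b '' {A | Odd A.card})) : x * y + y * x = 0 := by
  induction hx using Submodule.span_induction generalizing y with
  | mem z hz =>
    obtain ⟨A, hA, rfl⟩ := hz
    induction hy using Submodule.span_induction with
    | mem u hu =>
      obtain ⟨B, hB, rfl⟩ := hu
      exact weightBasis_mul_add_mul_eq_zero_of_odd b hA hB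
    | zero => rw [mul_zero, zero_mul, add_zero]
    | add u u' _ _ hu hu' => rw [mul_add, add_mul, add_add_add_comm, hu, hu', add_zero]
    | smul n u _ hu => rw [mul_smul_comm, smul_mul_assoc, ← smul_add, hu, smul_zero]
  | zero => rw [mul_zero, zero_mul, add_zero]
  | add z z' _ _ hz hz' => rw [add_mul, mul_add, add_add_add_comm, hz hy, hz' hy, add_zero]
  | smul n z _ hz => rw [smul_mul_assoc, mul_smul_comm, ← smul_add, hz hy, smul_zero]

/-- **Odd integral classes square to zero**: `x ∧ x = 0` for `x ∈ span_ℤ {w_A : |A| odd}` (`2x² = 0` and characteristic `0`).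
[cite: Kahn2026DividedPowers, Rem. 3.1 ("If j is odd … x² = 0 because 2x² = 0")] -/
theorem mul_self_eq_zero_of_mem_span_odd {x : ExteriorAlgebra K W} (hx : x ∈ Submodule.span ℤ (weightBasis b '' {A | Odd A.card})) :
    x * x = 0 := by
  have h := mul_add_mul_eq_zero_of_mem_span_odd b hx hx
  rw [← two_smul K] at h
  exact (smul_eq_zero.mp h).resolve_left two_ne_zero

omit [CharZero K] in
/-- The nilpotent binomial identity: `(e + o)^{r+1} = e^{r+1} + (r+1)·e^r ∧ o` for `e ∧ o = o ∧ e` and `o ∧ o = 0`.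
[cite: Kahn2026DividedPowers, §3 (proof of Prop. 1.1) and Rem. 3.1] -/
theorem add_pow_succ_of_commute_of_mul_self {R : Type*} [Ring R] {e o : R} (heo : Commute e o) (ho : o * o = 0) (r : ℕ) :
    (e + o) ^ (r + 1) = e ^ (r + 1) + (r + 1) • (e ^ r * o) := by
  induction r with
  | zero => rw [zero_add, pow_one, pow_one, pow_zero, one_mul, one_smul]
  | succ r ih =>
    rw [pow_succ, ih, add_mul, mul_add, mul_add, ← pow_succ, smul_mul_assoc, smul_mul_assoc, mul_assoc (e ^ r) o e, ← heo.eq,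
      ← mul_assoc (e ^ r) e o, ← pow_succ, mul_assoc (e ^ r) o o, ho, mul_zero, smul_zero, add_zero, add_assoc, ← succ_nsmul']

/-! ## §5 `H^{>0}(X, ℤ)` has divided powers: `x^r ∈ r!·H•(X, ℤ)` -/

/-- The nonempty index sets are the nonempty even ones and the odd ones (plumbing). [folklore] -/
private theorem setOf_nonempty_eq_union :
    ({A : Finset (Fin g ×ₗ Bool) | A.Nonempty}) = {A | A.Nonempty ∧ Even A.card} ∪ {A | Odd A.card} := by
  ext A
  simp only [Set.mem_setOf_eq, Set.mem_union]
  constructor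
  · intro h
    rcases Nat.even_or_odd A.card with he | ho
    · exact Or.inl ⟨h, he⟩
    · exact Or.inr ho
  · rintro (⟨h, -⟩ | ho)
    · exact h
    · exact Finset.card_pos.mp ho.pos

omit [CharZero K] in
/-- `H^{>0}(X, ℤ) = (even positive part) + (odd part)`. [cite: Kahn2026DividedPowers, §3 (proof of Prop. 1.1: "the even part of the cohomology algebra")]
[cite: BourbakiAlgebre1a3, Ch. III §7 no. 8 Thm. 1] -/
theorem span_image_weightBasis_nonempty_eq_sup :
    Submodule.span ℤ (weightBasis b '' {A | A.Nonempty}) =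
      Submodule.span ℤ (weightBasis b '' {A | A.Nonempty ∧ Even A.card}) ⊔ Submodule.span ℤ (weightBasis b '' {A | Odd A.card}) := by
  rw [setOf_nonempty_eq_union, Set.image_union, Submodule.span_union]

/-- **`H^{>0}(X, ℤ)` HAS DIVIDED POWERS: `x^r = r!·y` with `y ∈ H•(X, ℤ)` for every `x ∈ span_ℤ {w_A : A ≠ ∅}` and every `r`** — write
`x = e + o` (even positive + odd); `e` is central with `e^m ∈ m!·L` (§3), `o² = 0` (§4), so `x^{r+1} = e^{r+1} + (r+1)·e^r o ∈ (r+1)!·L`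
(Papy's arithmetic property of the Grassmann algebra over `ℤ`; Kahn: "Thus `cl(x^r) = cl(x)^r` is divisible by `r!`").
[cite: Kahn2026DividedPowers, §3 (proof of Prop. 1.1) and Rem. 3.1; Thm. 1.2 (a)] -/
theorem exists_pow_eq_factorial_smul_of_mem_span_nonempty {x : ExteriorAlgebra K W}
    (hx : x ∈ Submodule.span ℤ (weightBasis b '' {A | A.Nonempty})) (r : ℕ) :
    ∃ y ∈ Submodule.span ℤ (Set.range (weightBasis b)), x ^ r = (r ! : ℤ) • y := by
  rw [span_image_weightBasis_nonempty_eq_sup, Submodule.mem_sup] at hx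
  obtain ⟨e, he, o, ho, rfl⟩ := hx
  rcases r with _ | r
  · exact ⟨1, one_mem_span_weightBasis b, by rw [pow_zero, Nat.factorial_zero, Nat.cast_one, one_smul]⟩
  · obtain ⟨a, ha, hea⟩ := exists_pow_eq_factorial_smul_of_mem_span_even b he (r + 1)
    obtain ⟨a', ha', hea'⟩ := exists_pow_eq_factorial_smul_of_mem_span_even b he r
    refine ⟨a + a' * o, Submodule.add_mem _ ha (mul_mem_span_weightBasis b ha' (span_image_weightBasis_le b _ ho)), ?_⟩
    rw [add_pow_succ_of_commute_of_mul_self (commute_of_mem_span_even b he o) (mul_self_eq_zero_of_mem_span_odd b ho), hea, hea',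
      smul_mul_assoc, ← natCast_zsmul, smul_smul, smul_add, Nat.factorial_succ, Nat.cast_mul]

/-- **DIVIDED POWERS ON `H•(X, ℤ)`, coordinate form: if `x ∈ H•(X, ℤ)` has vanishing constant term `c_∅(x) = 0`, then `x^r ∈ r!·H•(X, ℤ)`
for every `r`** (the augmentation ideal of the integral cohomology ring `⋀_ℤ H¹(X, ℤ)` has divided powers).
[cite: Kahn2026DividedPowers, §3 (proof of Prop. 1.1: "x^r is divisible by r!") and Thm. 1.2 (a)] -/
theorem exists_pow_eq_factorial_smul {x : ExteriorAlgebra K W} (hx : x ∈ Submodule.span ℤ (Set.range (weightBasis b)))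
    (h0 : (weightBasis b).repr x ∅ = 0) (r : ℕ) :
    ∃ y ∈ Submodule.span ℤ (Set.range (weightBasis b)), x ^ r = (r ! : ℤ) • y :=
  exists_pow_eq_factorial_smul_of_mem_span_nonempty b ((mem_span_image_weightBasis_nonempty_iff b).mpr ⟨hx, h0⟩) r

/-! ## §6 The Pontryagin shadow: `x^{⋆r} ∈ r!·H•(X, ℤ)` for `x ∈ H^{<2g}(X, ℤ)` -/

variable {ω : ExteriorAlgebra K W}

/-- **`ℱ((x ⋆)^r [pt]) = (ℱx)^r`**: the Fourier transform turns iterated Pontryagin products with `x` (starting from the `⋆`-unit `[pt] = θ^g/g!`)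
into cup powers of `ℱx` (`ℱ(x ⋆ y) = ℱx ∧ ℱy`, `ℱ([pt]) = 1`, rows g37-#3/#4). [cite: BeckmannDeGaayFortman2023, §2 Thm. (Moonen–Polishchuk) ("n! x^{[n]} = x^{⋆n}")]
[cite: Kahn2026DividedPowers, Cor. 1.4] -/
theorem IsSymplectic.fourierTransform_pontryagin_pow_point (hω : IsSymplectic ω g) (hg : 0 < g) (x : ExteriorAlgebra K W) (r : ℕ) :
    fourierTransform ω g ((hω.pontryagin x ^ r) ((g ! : K)⁻¹ • ω ^ g)) = fourierTransform ω g x ^ r := by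
  induction r with
  | zero => rw [pow_zero, Module.End.one_apply, hω.fourierTransform_point hg, pow_zero]
  | succ r ih => rw [pow_succ', Module.End.mul_apply, hω.fourierTransform_pontryagin hg, ih, pow_succ']

/-- **`ℱ(H^{<2g}(X, ℤ)) ⊆ H^{>0}(X, ℤ)`**: the Fourier transform maps the integral classes with no point-class component into the integral
classes with no constant term (`ℱ(w_A) = ± w_{flip(Aᶜ)}` and `flip(Aᶜ) ≠ ∅` iff `A ≠ univ`, row g39-#1).
[cite: Lange2023AbelianVarietiesComplex, §6.2.4 Prop. 6.2.20 (proof, "F(e_I) = … f_{I°}")] [cite: Kahn2026DividedPowers, Cor. 1.4] -/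
theorem fourierTransform_mem_span_weightBasis_nonempty (hg : 0 < g) {x : ExteriorAlgebra K W}
    (hx : x ∈ Submodule.span ℤ (weightBasis b '' {A | A ≠ Finset.univ})) :
    fourierTransform (twoVector b) g x ∈ Submodule.span ℤ (weightBasis b '' {A | A.Nonempty}) := by
  induction hx using Submodule.span_induction with
  | mem y hy =>
    obtain ⟨A, hA, rfl⟩ := hy
    obtain ⟨n, hn⟩ := exists_fourierTransform_weightBasis_eq b hg A
    have hne : (flipSet Aᶜ).Nonempty := by
      rw [flipSet, Finset.map_nonempty, ← Finset.compl_ne_univ_iff_nonempty, compl_compl]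
      exact hA
    rw [hn]
    rcases neg_one_pow_eq_or K n with h | h
    · rw [h, one_smul]
      exact Submodule.subset_span ⟨_, hne, rfl⟩
    · rw [h, neg_one_smul]
      exact Submodule.neg_mem _ (Submodule.subset_span ⟨_, hne, rfl⟩)
  | zero => rw [map_zero]; exact Submodule.zero_mem _
  | add y z _ _ hy hz => rw [map_add]; exact Submodule.add_mem _ hy hz
  | smul n y _ hy => rw [map_zsmul]; exact Submodule.smul_mem _ n hy

/-- **THE PONTRYAGIN AUGMENTATION IDEAL HAS DIVIDED POWERS (on integral cohomology): for `x ∈ H•(X, ℤ)` with `c_{univ}(x) = 0` (no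
point-class component) and every `r`, `x^{⋆r} = (x ⋆)^r [pt] ∈ r!·H•(X, ℤ)`** — Kahn's Cor. 1.4 / the Moonen–Polishchuk PD-structure on
`(CH_{>0}, ⋆)` read in `H•(X, ℤ)`: `ℱ` is an integral ring isomorphism `(H•, ⋆) ⥲ (H•, ∧)` (`ℱ⁴ = 1`), `ℱ(x^{⋆r}) = (ℱx)^r ∈ r!·H•(X, ℤ)` by §5.
[cite: Kahn2026DividedPowers, Cor. 1.4 ("The augmentation ideal … provided with the Pontryagin product admits a canonical divided power structure")]
[cite: BeckmannDeGaayFortman2023, §2 Thm. (Moonen–Polishchuk) ("n! x^{[n]} = x^{⋆n}")] -/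
theorem exists_pontryagin_pow_point_eq_factorial_smul (hg : 0 < g) {x : ExteriorAlgebra K W}
    (hx : x ∈ Submodule.span ℤ (Set.range (weightBasis b))) (htop : (weightBasis b).repr x Finset.univ = 0) (r : ℕ) :
    ∃ y ∈ Submodule.span ℤ (Set.range (weightBasis b)),
      ((isSymplectic_twoVector b).pontryagin x ^ r) ((g ! : K)⁻¹ • twoVector b ^ g) = (r ! : ℤ) • y := by
  have hω := isSymplectic_twoVector b
  have hx' : x ∈ Submodule.span ℤ (weightBasis b '' {A | A ≠ Finset.univ}) :=
    (mem_span_image_weightBasis_ne_univ_iff b).mpr ⟨hx, htop⟩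
  obtain ⟨y', hy', hFy⟩ :=
    exists_pow_eq_factorial_smul_of_mem_span_nonempty b (fourierTransform_mem_span_weightBasis_nonempty b hg hx') r
  have h4 := hω.fourierTransform_pow_four hg
  refine ⟨(fourierTransform (twoVector b) g ^ 3) y', ?_, ?_⟩
  · rw [pow_succ, pow_two, Module.End.mul_apply, Module.End.mul_apply]
    exact fourierTransform_mem_span_weightBasis b hg (fourierTransform_mem_span_weightBasis b hg (fourierTransform_mem_span_weightBasis b hg hy'))
  · calc (hω.pontryagin x ^ r) ((g ! : K)⁻¹ • twoVector b ^ g)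
        = (fourierTransform (twoVector b) g ^ 4) ((hω.pontryagin x ^ r) ((g ! : K)⁻¹ • twoVector b ^ g)) := by rw [h4, Module.End.one_apply]
      _ = (fourierTransform (twoVector b) g ^ 3) (fourierTransform (twoVector b) g ((hω.pontryagin x ^ r) ((g ! : K)⁻¹ • twoVector b ^ g))) := by
          rw [pow_succ, Module.End.mul_apply]
      _ = (r ! : ℤ) • (fourierTransform (twoVector b) g ^ 3) y' := by
          rw [hω.fourierTransform_pontryagin_pow_point hg, hFy, map_zsmul]

end Field

end ExteriorLefschetz

end Literature.AlgebraicGeometry.Motives
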